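import Summits.BirchSwinnertonDyer.BirchSwinnertonDyer.Theorems.SylvesterTwoHeegnerIndexCoupledDescentCebotarev
import Summits.BirchSwinnertonDyer.BirchSwinnertonDyer.Theorems.SylvesterTwoHeegnerIndexCoupledTelescopeKernelForm
import Literature.NumberTheory.EllipticCurves.JZeroTwoPowerTorsionKummerPair
import Literature.NumberTheory.EllipticCurves.HeegnerPointsKolyvaginPairingCMConj
import Literature.NumberTheory.EllipticCurves.HeegnerPointsKolyvaginPairingMap
import Literature.NumberTheory.EllipticCurves.SelmerTorsionCMOperatorJZero
import HarnessLib

/-!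
# The COUPLED Cassels–Tate telescope, XXII: the (T-L3) leaf — ONE Kolyvagin prime realising BOTH kernel
# forms at level `2^M`, for `σ`-eigenclasses (pair Čebotarev with pivots, composed by name)

Crux `UpperOffV0HSYPlus` (stmt-BirchSwinnertonDyer-19804), rows' display RESIDUE c v3 (`…TailFourOfResidue`
p714972 / `…TailSevenOfResidue` p714989), clause (T-L3): for finite admissible `T_A, T_B`, admissible `g_A, g_B`
and any bound, ONE Kolyvagin prime `ℓ` of the level at which, for `X ∈ {A, B}` and `w := H¹(fn_X)`,
`∀ x ∈ closure (insert g_X (insert (w g_X) (T_X ∪ w '' T_X))), (∀ v ∋ ℓ, x ∈ Ker v) ↔ x ∈ closure (T_X ∪ w '' T_X)`.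
Proved here GENERICALLY (two elliptic curves over `ℚ`, `K` imaginary quadratic with conjugation `c` and its
involutive lift `τ`, level `n = 2^M`, per curve the CM operator `fn` on `X_K[n]`, `w`-stable local kernels, a
lifted mover, ONE `2`-torsion point of `X_K[n]` moved by `τ`) for `σ`-EIGEN classes (`σ_* x = ε • x`, `ε : ℤ`) —
the admissibility the rows' sets `Adm_X` must carry: for `T = {t}`, `g = σ_* t ∉ 𝒪 t` the kernel form FAILS at
every inert prime (`Ker_λ` is `σ`-stable).  COMPOSITION BY NAME (planner D675 (3) / D682 (1)) of KD²
`JZero.exists_h1Eval_pair_two_pow` (p721280), the pair Čebotarev step `exists_kolyvaginPrime_gt_of_galoisElement_pair`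
(transported from its `p ^ M` currency by `subst`, k-ty1 CHECK 3), the (O1) brick `kernelForm_closure_pair_iff` +
`forall_pow_smul_mem_of_pivot` (p720981), and the `(1+τ)`-bookkeeping `IsLiftOfAut.h1Eval_conjGalCMH`: for a
`σ`-eigenclass `y` killed by `m`, `[y, (ρm)^τ(ρm)] = ε • τ[y, ρ] + [y, ρ]`; killed `t ∈ T_X` are locally trivial
at `λ`, and the PIVOT `2^(i−1) • g_X` (`i` = order-exponent of `g_X` modulo the small closure) has value
`ε • τπ + π ≠ 0` (`π` a `2`-torsion point with `τπ ≠ π`) for EITHER parity of `ε`.  New elementary inputs: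
`dvd_and_dvd_of_pair_smul_mem_closure` (the `ℤ[ω]`-annihilator of `g` modulo the small closure is `2^i ℤ[ω]`),
`exists_zsmul_eq_of_two_torsion`, `zsmul_map_add_ne_zero_of_two_torsion`.  ★ `cebotarev_kernelForm_pair`.
The display-currency instantiation (`(cubeSumCurve ·).baseChange K`, `2^κ·2^κ`, the sets `Adm_X` and the
predicate `Kol`) is the sibling file.  Theorem-only (no definition, no named fact); nothing asserted on 19804;
no stub closed; X12.CMAtTwo NOT proved; BSD not claimed for any curve.  Sources: McCallum 1991 §3 Prop. 3.1 /
(3), §5 Thm. 5.4; Gross 1991 §9 Props. 9.3, 9.6; Kolyvagin 1990 §4; Rubin 1999 §6; MEMO-bsd-cm-two §57.4, §59.2.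
-/

-- every Summits module is named `Summit.<Summit>.<Problem>…`: the duplicated component is by design
set_option linter.dupNamespace false
set_option autoImplicit false

noncomputable section

open scoped Classical
open WeierstrassCurve NumberField IsDedekindDomain Field
open Literature.NumberTheory.EllipticCurves Literature.NumberTheory.GaloisRepresentations

universe u

namespace Summit.BirchSwinnertonDyer.BirchSwinnertonDyer.Theorems.SylvesterTwoCoupledTelescope

/-! ## The `ℤ[ω]`-annihilator of a class modulo the small closure -/

section MinimalExponent

variable {S : Type*} [AddCommGroup S] (w : S →+ S)

/-- **The annihilator modulo the small closure is `2^i ℤ[ω]`.**  For an abelian group killed by `2^m`,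
an additive `w` with `w (w x) + w x + x = 0`, the small closure `V = closure (T ∪ w '' T)` and an element
`g` with `2^j • g ∉ V` for all `j < i`: if `a • g + b • w g ∈ V` then `2^i ∣ a` and `2^i ∣ b`
(induction on `i`: halve when `a, b` are both even; otherwise the norm `a² − ab + b²` is odd, so
`g ∈ V` by the conjugate identity `conj_smul_pair_eq` and Bezout with `2^m` — contradicting `j = 0`).
[cite: McCallumLMS1991, §5 (proof of Thm. 5.4)] -/
theorem dvd_and_dvd_of_pair_smul_mem_closure (hw : ∀ x, w (w x) + w x + x = 0) (m : ℕ)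
    (hm : ∀ x : S, ((2 : ℤ) ^ m) • x = 0) (T : Set S) :
    ∀ (i : ℕ) (g : S), (∀ j < i, ((2 : ℤ) ^ j) • g ∉ AddSubgroup.closure (T ∪ w '' T)) →
      ∀ a b : ℤ, a • g + b • w g ∈ AddSubgroup.closure (T ∪ w '' T) →
        (2 : ℤ) ^ i ∣ a ∧ (2 : ℤ) ^ i ∣ b := by
  intro i
  induction i with
  | zero => intro g _ a b _; simp
  | succ i ih =>
    intro g hmin a b hab
    by_cases h2 : 2 ∣ a ∧ 2 ∣ b
    · obtain ⟨⟨a₁, rfl⟩, ⟨b₁, rfl⟩⟩ := h2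
      have he : (2 * a₁) • g + (2 * b₁) • w g = a₁ • ((2 : ℤ) • g) + b₁ • w ((2 : ℤ) • g) := by
        rw [map_zsmul, smul_smul, smul_smul, mul_comm a₁ 2, mul_comm b₁ 2]
      rw [he] at hab
      have hmin₂ : ∀ j < i, ((2 : ℤ) ^ j) • ((2 : ℤ) • g) ∉ AddSubgroup.closure (T ∪ w '' T) := by
        intro j hj
        rw [smul_smul, ← pow_succ]
        exact hmin (j + 1) (by omega)
      obtain ⟨⟨c, hc⟩, ⟨d, hd⟩⟩ := ih ((2 : ℤ) • g) hmin₂ a₁ b₁ hab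
      exact ⟨⟨c, by rw [pow_succ, hc]; ring⟩, ⟨d, by rw [pow_succ, hd]; ring⟩⟩
    · exfalso
      have hodd : Odd (a * a - a * b + b * b) := by
        rw [← Int.not_even_iff_odd]
        rw [← even_iff_two_dvd, ← even_iff_two_dvd] at h2
        simp only [Int.even_add, Int.even_sub, Int.even_mul]
        tauto
      have hNg : (a * a - a * b + b * b) • g ∈ AddSubgroup.closure (T ∪ w '' T) := by
        rw [← conj_smul_pair_eq w hw g a b]
        exact add_mem (AddSubgroup.zsmul_mem _ hab _)
          (AddSubgroup.zsmul_mem _ (map_mem_closure_union_image w hw T hab) _)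
      have hcop : IsCoprime (a * a - a * b + b * b) ((2 : ℤ) ^ m) := by
        obtain ⟨k, hk⟩ := hodd
        exact (show IsCoprime (a * a - a * b + b * b) 2 from ⟨1, -k, by rw [hk]; ring⟩).pow_right
      have hg : g ∈ AddSubgroup.closure (T ∪ w '' T) := by
        obtain ⟨u, v, huv⟩ := hcop
        have e : g = u • ((a * a - a * b + b * b) • g) + v • (((2 : ℤ) ^ m) • g) := by
          rw [smul_smul, smul_smul, ← add_smul, huv, one_smul]
        rw [e, hm g, smul_zero, add_zero]
        exact AddSubgroup.zsmul_mem _ hNg _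
      exact hmin 0 (Nat.succ_pos i) (by simpa using hg)

end MinimalExponent

/-! ## Two torsion facts -/

section Torsion

variable {K : Type u} [Field K] [CharZero K]

/-- **Divisibility inside `X[2^M]`**: a `2`-torsion point `π` of `X[n]`, `n = 2^M`, is `2^(i−1) • u`
for some `u ∈ X[n]` with `2^i • u = 0`, for every `1 ≤ i ≤ M` (`X(K̄)` is divisible:
`zsmul_geomPoints_surjective_of_charZero`). [cite: SilvermanAEC2009, Cor. III.6.4(b)] -/
theorem exists_zsmul_eq_of_two_torsion (X : WeierstrassCurve K) (n : ℕ) {M : ℕ} (hn : n = 2 ^ M)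
    (π : geomTorsion X (n : ℤ)) (hπ : (2 : ℤ) • π = 0) (i : ℕ) (hi1 : 1 ≤ i) (hiM : i ≤ M) :
    ∃ u : geomTorsion X (n : ℤ), ((2 : ℤ) ^ (i - 1)) • u = π ∧ ((2 : ℤ) ^ i) • u = 0 := by
  obtain ⟨Q, hQ⟩ := X.zsmul_geomPoints_surjective_of_charZero
    (pow_ne_zero (i - 1) (two_ne_zero : (2 : ℤ) ≠ 0)) (π : geomPoints X)
  simp only at hQ
  have hπ' : (2 : ℤ) • (π : geomPoints X) = 0 := by
    rw [← AddSubgroupClass.coe_zsmul, hπ, ZeroMemClass.coe_zero]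
  have h2i : ((2 : ℤ) ^ i) • Q = 0 := by
    rw [show ((2 : ℤ) ^ i) = 2 * (2 : ℤ) ^ (i - 1) by rw [← pow_succ']; congr 1; omega,
      mul_smul, hQ, hπ']
  have hQn : Q ∈ geomTorsion X (n : ℤ) := by
    rw [mem_geomTorsion_iff, hn, Nat.cast_pow, Nat.cast_ofNat,
      show ((2 : ℤ) ^ M) = (2 : ℤ) ^ (M - i) * (2 : ℤ) ^ i by rw [← pow_add]; congr 1; omega,
      mul_smul, h2i, smul_zero]
  refine ⟨⟨Q, hQn⟩, Subtype.ext ?_, Subtype.ext ?_⟩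
  · rw [AddSubgroupClass.coe_zsmul]; exact hQ
  · rw [AddSubgroupClass.coe_zsmul, ZeroMemClass.coe_zero]; exact h2i

end Torsion

/-- **The pivot value is non-zero for either parity of the sign**: for an additive `f` (here `τ` on
`X[n]`) and a `2`-torsion `π` with `f π ≠ π`, `ε • f π + π ≠ 0` for every `ε : ℤ` (`ε` even: the value
is `π ≠ 0`; `ε` odd: it is `f π + π`, and `−π = π`). [folklore] -/
theorem zsmul_map_add_ne_zero_of_two_torsion {X : Type*} [AddCommGroup X] (f : X →+ X) (π : X)
    (hπ : (2 : ℤ) • π = 0) (hne : f π ≠ π) (ε : ℤ) : ε • f π + π ≠ 0 := by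
  have hπ0 : π ≠ 0 := by rintro rfl; exact hne (map_zero f)
  have h2f : (2 : ℤ) • f π = 0 := by rw [← map_zsmul, hπ, map_zero]
  have hff : f π + f π = 0 := by rwa [two_zsmul] at h2f
  have hππ : π + π = 0 := by rwa [two_zsmul] at hπ
  intro h
  obtain ⟨k, rfl | rfl⟩ := Int.even_or_odd' ε
  · apply hπ0
    rwa [mul_zsmul', two_zsmul, hff, zsmul_zero, zero_add] at h
  · apply hne
    rw [add_zsmul, one_zsmul, mul_zsmul', two_zsmul, hff, zsmul_zero, zero_add] at h
    rw [eq_neg_of_add_eq_zero_left h, neg_eq_of_add_eq_zero_left hππ]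

/-! ## Per curve: the pivot target, and the kernel form from the local criterion -/

section PerCurve

variable {K : Type u} [Field K] [NumberField K] (X : WeierstrassCurve ℚ) (n : ℕ) {M : ℕ} (hn : n = 2 ^ M)
  (fn : geomTorsion (X.baseChange K) (n : ℤ) →+ geomTorsion (X.baseChange K) (n : ℤ))
  (hfn : ∀ (g : absoluteGaloisGroup K) (Q : geomTorsion (X.baseChange K) (n : ℤ)),
    fn (ContinuousMonoidHom.id _ g • Q) = g • fn Q)
include hn

/-- **The pivot exponent and the target value, per curve.**  For a class `g`, a finite `T` and a `2`-torsion
`π ∈ X_K[n]` (`n = 2^M`): the order-exponent `i` of `g` modulo `V := closure (T ∪ w '' T)` (`2^i • g ∈ V`, `i`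
minimal) and a target `u ∈ X_K[n]` with `2^(i−1) • u = π` (if `i ≠ 0`) killed by the `ℤ[fn]`-annihilator of `g`
modulo `V` — the `huX` input of KD² `JZero.exists_h1Eval_pair_two_pow`. [cite: McCallumLMS1991, §5 Thm. 5.4] -/
theorem exists_exponent_target (hrel : ∀ Q, fn (fn Q) + fn Q + Q = 0)
    (π : geomTorsion (X.baseChange K) (n : ℤ)) (hπ : (2 : ℤ) • π = 0)
    (T : Finset (galH1Torsion (X.baseChange K) (n : ℤ))) (g : galH1Torsion (X.baseChange K) (n : ℤ)) :
    ∃ (i : ℕ) (u : geomTorsion (X.baseChange K) (n : ℤ)),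
      ((2 : ℤ) ^ i) • g ∈ AddSubgroup.closure ((T : Set _) ∪ resH1Hom (ContinuousMonoidHom.id _) fn hfn '' (T : Set _)) ∧
      (i ≠ 0 → ((2 : ℤ) ^ (i - 1)) • u = π) ∧
      ∀ a b : ℤ, a • g + b • resH1Hom (ContinuousMonoidHom.id _) fn hfn g ∈
        AddSubgroup.closure ((T : Set _) ∪ resH1Hom (ContinuousMonoidHom.id _) fn hfn '' (T : Set _)) →
        a • u + b • fn u = 0 := by
  subst hn
  set w := resH1Hom (ContinuousMonoidHom.id _) fn hfn with hwdef
  set V := AddSubgroup.closure ((T : Set _) ∪ w '' (T : Set _)) with hVdef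
  have hw2 : ∀ x, w (w x) + w x + x = 0 := resH1Hom_id_apply_apply_add _ fn hfn hrel
  have hkill : ∀ x : galH1Torsion (X.baseChange K) ((2 ^ M : ℕ) : ℤ), ((2 : ℤ) ^ M) • x = 0 := fun x ↦ by
    rw [show ((2 : ℤ) ^ M) = (((2 ^ M : ℕ) : ℤ)) by push_cast; ring]
    exact zsmul_galH1Torsion_eq_zero _ _ x
  have hex : ∃ i : ℕ, ((2 : ℤ) ^ i) • g ∈ V := ⟨M, by rw [hkill]; exact zero_mem _⟩
  obtain ⟨i, hi, himin⟩ : ∃ i, ((2 : ℤ) ^ i) • g ∈ V ∧ ∀ j < i, ((2 : ℤ) ^ j) • g ∉ V :=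
    ⟨Nat.find hex, Nat.find_spec hex, fun j hj ↦ Nat.find_min hex hj⟩
  have hiM : i ≤ M := by
    by_contra h
    exact himin M (by omega) (by rw [hkill]; exact zero_mem _)
  obtain ⟨u, hu0, hupiv⟩ : ∃ u : geomTorsion (X.baseChange K) ((2 ^ M : ℕ) : ℤ),
      ((2 : ℤ) ^ i) • u = 0 ∧ (i ≠ 0 → ((2 : ℤ) ^ (i - 1)) • u = π) := by
    by_cases h0 : i = 0
    · exact ⟨0, smul_zero _, fun h ↦ absurd h0 h⟩
    · obtain ⟨u, hu, hu0⟩ := exists_zsmul_eq_of_two_torsion (X.baseChange K) (2 ^ M) rfl π hπ i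
        (Nat.one_le_iff_ne_zero.mpr h0) hiM
      exact ⟨u, hu0, fun _ ↦ hu⟩
  refine ⟨i, u, hi, hupiv, fun a b hab ↦ ?_⟩
  obtain ⟨⟨a', rfl⟩, ⟨b', rfl⟩⟩ := dvd_and_dvd_of_pair_smul_mem_closure w hw2 M hkill _ i g himin a b hab
  rw [mul_comm _ a', mul_smul, hu0, smul_zero, mul_comm _ b', mul_smul, ← map_zsmul, hu0, map_zero,
    smul_zero, add_zero]

/-- **The kernel form of ONE curve from the local criterion at a Čebotarev prime.**  With `τ` an involutive
lift of `c`, `w := resH1Hom id fn` preserving the local kernels, a `2`-torsion `π ∈ X_K[n]` with `τπ ≠ π`,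
`σ`-EIGEN `g` and `T`, the pivot data `(i, u)` of `exists_exponent_target`, `ρ ∈ Γ_{K(X[n])}` killing `T` with
`[g, ρ] = u`, `m` killing a family `cs` whose range contains `g, w g, T, w T`, and McCallum's (3) at the places
`v ∋ ℓ` — «`x_v = 0 ⟺ [x, (ρm)^τ(ρm)] = 0`» on the span of `cs` —: on the big closure, «locally trivial at every
`v ∋ ℓ`» ⟺ «small».  (`[y, (ρm)^τ(ρm)] = ε • τ[y, ρ] + [y, ρ]` for an eigenclass `y` killed by `m`
(`IsLiftOfAut.h1Eval_conjGalCMH`); `T` is killed; the pivot `2^(i−1) • g` has value `ε • τπ + π ≠ 0`; then the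
(O1) brick.) [cite: McCallumLMS1991, §3 (3); §5 Thm. 5.4] [cite: GrossLMS1991, §9 Prop. 9.6] -/
theorem kernelForm_of_localCriterion {c : K ≃ₐ[ℚ] K} {τ : AlgebraicClosure K ≃+* AlgebraicClosure K}
    (ht : IsLiftOfAut c τ) (hinv : ∀ x, τ (τ x) = x) (hrel : ∀ Q, fn (fn Q) + fn Q + Q = 0)
    (hKer : ∀ v : HeightOneSpectrum (𝓞 K), ∀ x ∈ (X.baseChange K).torsionLocalKer (v.adicCompletion K) (n : ℤ),
      resH1Hom (ContinuousMonoidHom.id _) fn hfn x ∈ (X.baseChange K).torsionLocalKer (v.adicCompletion K) (n : ℤ))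
    (π : geomTorsion (X.baseChange K) (n : ℤ)) (hπ : (2 : ℤ) • π = 0) (hπτ : ht.torsionMap X (n : ℤ) π ≠ π)
    (T : Finset (galH1Torsion (X.baseChange K) (n : ℤ))) (g : galH1Torsion (X.baseChange K) (n : ℤ))
    (hg : ∃ ε : ℤ, conjAct X c (n : ℤ) g = ε • g) (hT : ∀ t ∈ T, ∃ ε : ℤ, conjAct X c (n : ℤ) t = ε • t)
    (i : ℕ) (u : geomTorsion (X.baseChange K) (n : ℤ))
    (hi : ((2 : ℤ) ^ i) • g ∈ AddSubgroup.closure ((T : Set _) ∪ resH1Hom (ContinuousMonoidHom.id _) fn hfn '' (T : Set _)))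
    (hupiv : i ≠ 0 → ((2 : ℤ) ^ (i - 1)) • u = π)
    {ρ m : absoluteGaloisGroup K} (hρ : ρ ∈ torsionFixing (X.baseChange K) (n : ℤ))
    (hT0 : ∀ t ∈ T, h1Eval (X.baseChange K) (n : ℤ) t ρ = 0) (hv : h1Eval (X.baseChange K) (n : ℤ) g ρ = u)
    {ι : Type*} (cs : ι → galH1Torsion (X.baseChange K) (n : ℤ))
    (hm : m ∈ evalKer (X.baseChange K) (n : ℤ) cs)
    (hcs : insert g (insert (resH1Hom (ContinuousMonoidHom.id _) fn hfn g)
      ((T : Set _) ∪ resH1Hom (ContinuousMonoidHom.id _) fn hfn '' (T : Set _))) ⊆ Set.range cs)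
    {ℓ : ℕ} (hℓ : ℓ.Prime) (hℓP : (Ideal.span {(ℓ : 𝓞 K)}).IsPrime)
    (hcrit : ∀ x ∈ AddSubgroup.closure (Set.range cs), ∀ v : HeightOneSpectrum (𝓞 K), (ℓ : 𝓞 K) ∈ v.asIdeal →
      (x ∈ (X.baseChange K).torsionLocalKer (v.adicCompletion K) (n : ℤ) ↔
        h1Eval (X.baseChange K) (n : ℤ) x (ht.conjGalCMH (ρ * m) * (ρ * m)) = 0)) :
    ∀ x ∈ AddSubgroup.closure (insert g (insert (resH1Hom (ContinuousMonoidHom.id _) fn hfn g)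
        ((T : Set _) ∪ resH1Hom (ContinuousMonoidHom.id _) fn hfn '' (T : Set _)))),
      (∀ v : HeightOneSpectrum (𝓞 K), (ℓ : 𝓞 K) ∈ v.asIdeal →
        x ∈ (X.baseChange K).torsionLocalKer (v.adicCompletion K) (n : ℤ)) ↔
      x ∈ AddSubgroup.closure ((T : Set _) ∪ resH1Hom (ContinuousMonoidHom.id _) fn hfn '' (T : Set _)) := by
  subst hn
  set w := resH1Hom (ContinuousMonoidHom.id _) fn hfn with hwdef
  have hw2 : ∀ x, w (w x) + w x + x = 0 := resH1Hom_id_apply_apply_add _ fn hfn hrel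
  have hm' := (mem_evalKer_iff _ _).mp hm
  -- evaluation of `F = (ρm)^τ (ρm)` on a `σ`-eigenclass killed by `m`
  have hρm : ρ * m ∈ torsionFixing (X.baseChange K) ((2 ^ M : ℕ) : ℤ) := mul_mem hρ hm'.1
  have hcj : ht.conjGalCMH (ρ * m) ∈ torsionFixing (X.baseChange K) ((2 ^ M : ℕ) : ℤ) :=
    ht.conjGalCMH_mem_torsionFixing X hinv _ hρm
  have heval : ∀ (y : galH1Torsion (X.baseChange K) ((2 ^ M : ℕ) : ℤ)) (ε : ℤ), conjAct X c _ y = ε • y →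
      h1Eval _ _ y m = 0 → h1Eval _ _ y (ht.conjGalCMH (ρ * m) * (ρ * m)) =
        ε • ht.torsionMap X _ (h1Eval _ _ y ρ) + h1Eval _ _ y ρ := by
    intro y ε hy hym
    rw [h1Eval_mul _ _ y hcj, ht.h1Eval_conjGalCMH X hinv _ y hρm, hy, h1Eval_zsmul _ _ ε y hρm,
      h1Eval_mul _ _ y hρ, hym, add_zero, map_zsmul]
  -- the values of `m` vanish on `g` and on `T` (they lie in the range of `cs`)
  have hkm : ∀ y ∈ Set.range cs, h1Eval _ _ y m = 0 := by rintro _ ⟨j, rfl⟩; exact hm'.2 j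
  -- `T` is locally trivial at every place above `ℓ`
  have hTloc : ∀ t ∈ (T : Set _), ∀ v : HeightOneSpectrum (𝓞 K), (ℓ : 𝓞 K) ∈ v.asIdeal →
        t ∈ (X.baseChange K).torsionLocalKer (v.adicCompletion K) ((2 ^ M : ℕ) : ℤ) := by
    intro t ht' v hv
    obtain ⟨ε, hε⟩ := hT t ht'
    have htcs : t ∈ Set.range cs := hcs (Or.inr (Or.inr (Or.inl ht')))
    refine (hcrit t (AddSubgroup.subset_closure htcs) v hv).mpr ?_
    rw [heval t ε hε (hkm t htcs), hT0 t ht', map_zero, smul_zero, add_zero]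
  -- the pivot `2^(i−1) • g` is NOT locally trivial at the place `λ = (ℓ)`
  have hℓ0 : (ℓ : 𝓞 K) ≠ 0 := by exact_mod_cast hℓ.ne_zero
  let v₀ : HeightOneSpectrum (𝓞 K) :=
    ⟨Ideal.span {(ℓ : 𝓞 K)}, hℓP, by rw [Ne, Ideal.span_singleton_eq_bot]; exact hℓ0⟩
  have hv₀ : (ℓ : 𝓞 K) ∈ v₀.asIdeal := Ideal.mem_span_singleton_self _
  have hgcs : g ∈ Set.range cs := hcs (Or.inl rfl)
  have hpiv : i ≠ 0 → ¬ ∀ v : HeightOneSpectrum (𝓞 K), (ℓ : 𝓞 K) ∈ v.asIdeal →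
      ((2 : ℤ) ^ (i - 1)) • g ∈ (X.baseChange K).torsionLocalKer (v.adicCompletion K) ((2 ^ M : ℕ) : ℤ) := by
    intro hi0 hall
    obtain ⟨ε, hε⟩ := hg
    have hmem : ((2 : ℤ) ^ (i - 1)) • g ∈ AddSubgroup.closure (Set.range cs) :=
      AddSubgroup.zsmul_mem (AddSubgroup.closure (Set.range cs)) (AddSubgroup.subset_closure hgcs) _
    have h0 := (hcrit _ hmem v₀ hv₀).mp (hall v₀ hv₀)
    rw [heval _ ε (by rw [map_zsmul, hε, smul_comm]) (by rw [h1Eval_zsmul _ _ _ _ hm'.1, hkm g hgcs,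
      smul_zero]), h1Eval_zsmul _ _ _ _ hρ, hv, hupiv hi0] at h0
    exact zsmul_map_add_ne_zero_of_two_torsion (ht.torsionMap X _) π hπ hπτ ε h0
  -- the (O1) brick
  exact kernelForm_closure_pair_iff w hw2 (2 ^ M) M (fun x ↦ zsmul_galH1Torsion_eq_zero _ _ x) dvd_rfl
    (fun v : HeightOneSpectrum (𝓞 K) ↦ (ℓ : 𝓞 K) ∈ v.asIdeal)
    (fun v ↦ (X.baseChange K).torsionLocalKer (v.adicCompletion K) ((2 ^ M : ℕ) : ℤ))
    (fun v _ x hx ↦ hKer v x hx) _ hTloc g (forall_pow_smul_mem_of_pivot _ _ _ g i hi hpiv)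

end PerCurve

/-! ## The (T-L3) leaf, generic level-`2^M` form -/

section Main

variable {K : Type u} [Field K] [NumberField K] {A B : WeierstrassCurve ℚ} [A.IsElliptic] [B.IsElliptic]

/-- ★ **The (T-L3) leaf of RESIDUE c v3 — ONE Kolyvagin prime of level `n = 2^M` realising BOTH kernel
forms, for `σ`-eigen data.**  `K` imaginary quadratic with complex conjugation `c` (involutive lift `τ` as
in the pair Čebotarev theorem), `A, B / ℚ` elliptic; per curve `X`: the CM operator `fn_X` on `X_K[n]`
(`fn² + fn + 1 = 0`, `Γ_K`-equivariant), `X_K[n]^{Γ_K} = 0` (`hnofix`), the local kernels `Ker_v` stable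
under `w_X := resH1Hom id fn_X` (`hKer`), a `2`-torsion point of `X_K[n]` moved by `τ` (`hπ`), and a mover
`z_X ∈ Γ_{K(Y[n])}` with `z_X − 1` bijective on `X_K[n]`.  Then for finite families `T_A, T_B` and classes
`g_A, g_B`, all `σ`-EIGEN (`σ_* x = ε • x`), and every bound `b`, there is a prime `ℓ > b` with
`ℓ ∤ N_A`, `ℓ ∤ N_B`, `ℓ ∤ d_K`, `ℓ ≠ 2`, `(ℓ)` prime in `𝓞 K`, `Frob ℓ = Frob ∞` on `K(A[n])` and on `K(B[n])`,
such that for BOTH curves: on `closure (insert g_X (insert (w g_X) (T_X ∪ w '' T_X)))`, «locally trivial at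
every `v ∋ ℓ`» ⟺ «in `closure (T_X ∪ w '' T_X)`».  Proof: `exists_exponent_target` ×2 → KD² → pair Čebotarev
→ `kernelForm_of_localCriterion` ×2. [cite: McCallumLMS1991, §3 Prop. 3.1, (3); §5 Thm. 5.4]
[cite: GrossLMS1991, §9 Props. 9.3, 9.6] [cite: KolyvaginEulerSystems1990, §4] -/
theorem cebotarev_kernelForm_pair {NA NB : ℕ} [NeZero NA] [NeZero NB]
    (hK : IsImaginaryQuadratic K)
    {c : K ≃ₐ[ℚ] K} {c₀ : absoluteGaloisGroup ℚ} (hc₀ : IsComplexConjugation (Rat.castHom ℝ) c₀)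
    (ht : IsLiftOfAut c (absGaloisTransport (K := ℚ) (L := K) c₀).toRingEquiv)
    (hinv : ∀ x, (absGaloisTransport (K := ℚ) (L := K) c₀).toRingEquiv
      ((absGaloisTransport (K := ℚ) (L := K) c₀).toRingEquiv x) = x)
    (n : ℕ) [NeZero n] {M : ℕ} (hn : n = 2 ^ M) (hM : 1 ≤ M)
    -- curve `A`
    (fnA : geomTorsion (A.baseChange K) (n : ℤ) →+ geomTorsion (A.baseChange K) (n : ℤ))
    (hrelA : ∀ Q, fnA (fnA Q) + fnA Q + Q = 0)
    (hfnA : ∀ (g : absoluteGaloisGroup K) (Q : geomTorsion (A.baseChange K) (n : ℤ)),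
      fnA (ContinuousMonoidHom.id _ g • Q) = g • fnA Q)
    (hnofixA : ∀ Q : geomTorsion (A.baseChange K) (n : ℤ), (∀ g : absoluteGaloisGroup K, g • Q = Q) → Q = 0)
    (hKerA : ∀ v : HeightOneSpectrum (𝓞 K), ∀ x ∈ (A.baseChange K).torsionLocalKer (v.adicCompletion K) (n : ℤ),
      resH1Hom (ContinuousMonoidHom.id _) fnA hfnA x ∈ (A.baseChange K).torsionLocalKer (v.adicCompletion K) (n : ℤ))
    (hπA : ∃ π : geomTorsion (A.baseChange K) (n : ℤ), (2 : ℤ) • π = 0 ∧ ht.torsionMap A (n : ℤ) π ≠ π)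
    -- curve `B`
    (fnB : geomTorsion (B.baseChange K) (n : ℤ) →+ geomTorsion (B.baseChange K) (n : ℤ))
    (hrelB : ∀ Q, fnB (fnB Q) + fnB Q + Q = 0)
    (hfnB : ∀ (g : absoluteGaloisGroup K) (Q : geomTorsion (B.baseChange K) (n : ℤ)),
      fnB (ContinuousMonoidHom.id _ g • Q) = g • fnB Q)
    (hnofixB : ∀ Q : geomTorsion (B.baseChange K) (n : ℤ), (∀ g : absoluteGaloisGroup K, g • Q = Q) → Q = 0)
    (hKerB : ∀ v : HeightOneSpectrum (𝓞 K), ∀ x ∈ (B.baseChange K).torsionLocalKer (v.adicCompletion K) (n : ℤ),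
      resH1Hom (ContinuousMonoidHom.id _) fnB hfnB x ∈ (B.baseChange K).torsionLocalKer (v.adicCompletion K) (n : ℤ))
    (hπB : ∃ π : geomTorsion (B.baseChange K) (n : ℤ), (2 : ℤ) • π = 0 ∧ ht.torsionMap B (n : ℤ) π ≠ π)
    -- the movers (level-`2` Kummer independence of the two curves, lifted: `JZero.moving_lift`)
    {zA zB : absoluteGaloisGroup K} (hzA : zA ∈ torsionFixing (B.baseChange K) (n : ℤ))
    (hzAbij : Function.Bijective fun P : geomTorsion (A.baseChange K) (n : ℤ) ↦ zA • P - P)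
    (hzB : zB ∈ torsionFixing (A.baseChange K) (n : ℤ))
    (hzBbij : Function.Bijective fun P : geomTorsion (B.baseChange K) (n : ℤ) ↦ zB • P - P)
    -- the `σ`-eigen data
    (TA : Finset (galH1Torsion (A.baseChange K) (n : ℤ))) (TB : Finset (galH1Torsion (B.baseChange K) (n : ℤ)))
    (gA : galH1Torsion (A.baseChange K) (n : ℤ)) (gB : galH1Torsion (B.baseChange K) (n : ℤ))
    (hgA : ∃ ε : ℤ, conjAct A c (n : ℤ) gA = ε • gA) (hgB : ∃ ε : ℤ, conjAct B c (n : ℤ) gB = ε • gB)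
    (hTA : ∀ t ∈ TA, ∃ ε : ℤ, conjAct A c (n : ℤ) t = ε • t)
    (hTB : ∀ t ∈ TB, ∃ ε : ℤ, conjAct B c (n : ℤ) t = ε • t) (b : ℕ) :
    ∃ ℓ : ℕ, b < ℓ ∧ ℓ.Prime ∧ ¬ ℓ ∣ NA ∧ ¬ ℓ ∣ NB ∧ ¬ ((ℓ : ℤ) ∣ NumberField.discr K) ∧ ℓ ≠ 2 ∧
      (Ideal.span {(ℓ : 𝓞 K)}).IsPrime ∧ FrobEqFrobInfty A K n ℓ ∧ FrobEqFrobInfty B K n ℓ ∧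
      (∀ x ∈ AddSubgroup.closure (insert gA (insert (resH1Hom (ContinuousMonoidHom.id _) fnA hfnA gA)
          ((TA : Set _) ∪ resH1Hom (ContinuousMonoidHom.id _) fnA hfnA '' (TA : Set _)))),
        (∀ v : HeightOneSpectrum (𝓞 K), (ℓ : 𝓞 K) ∈ v.asIdeal →
          x ∈ (A.baseChange K).torsionLocalKer (v.adicCompletion K) (n : ℤ)) ↔
        x ∈ AddSubgroup.closure ((TA : Set _) ∪ resH1Hom (ContinuousMonoidHom.id _) fnA hfnA '' (TA : Set _))) ∧
      (∀ y ∈ AddSubgroup.closure (insert gB (insert (resH1Hom (ContinuousMonoidHom.id _) fnB hfnB gB)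
          ((TB : Set _) ∪ resH1Hom (ContinuousMonoidHom.id _) fnB hfnB '' (TB : Set _)))),
        (∀ v : HeightOneSpectrum (𝓞 K), (ℓ : 𝓞 K) ∈ v.asIdeal →
          y ∈ (B.baseChange K).torsionLocalKer (v.adicCompletion K) (n : ℤ)) ↔
        y ∈ AddSubgroup.closure ((TB : Set _) ∪ resH1Hom (ContinuousMonoidHom.id _) fnB hfnB '' (TB : Set _))) := by
  subst hn
  set wA := resH1Hom (ContinuousMonoidHom.id _) fnA hfnA with hwAdef
  set wB := resH1Hom (ContinuousMonoidHom.id _) fnB hfnB with hwBdef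
  -- ### the pivot data per curve, then KD²: ONE `ρ` killing `T_A`, `T_B` with `[g_X, ρ] = u_X`
  obtain ⟨πA, hπA2, hπAτ⟩ := hπA
  obtain ⟨πB, hπB2, hπBτ⟩ := hπB
  obtain ⟨iA, uA, hiA, huApiv, huA⟩ := exists_exponent_target A (2 ^ M) rfl fnA hfnA hrelA πA hπA2 TA gA
  obtain ⟨iB, uB, hiB, huBpiv, huB⟩ := exists_exponent_target B (2 ^ M) rfl fnB hfnB hrelB πB hπB2 TB gB
  obtain ⟨ρ, hρ, hTA0, hvA, hTB0, hvB⟩ := JZero.exists_h1Eval_pair_two_pow (A.baseChange K)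
    (B.baseChange K) (2 ^ M) rfl hM fnA hrelA (fun g Q ↦ hfnA g Q) hnofixA wA
    (forall_h1Eval_resH1Hom_id _ _ fnA hfnA) fnB hrelB (fun g Q ↦ hfnB g Q) hnofixB wB
    (forall_h1Eval_resH1Hom_id _ _ fnB hfnB) hzA hzAbij hzB hzBbij TA gA uA huA TB gB uB huB
  have hρA : ρ ∈ torsionFixing (A.baseChange K) ((2 ^ M : ℕ) : ℤ) := (Subgroup.mem_inf.mp hρ).1
  have hρB : ρ ∈ torsionFixing (B.baseChange K) ((2 ^ M : ℕ) : ℤ) := (Subgroup.mem_inf.mp hρ).2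
  -- ### the pair Čebotarev step on the families `{g_X, w g_X} ∪ T_X ∪ w T_X`
  let csA : Option (TA : Type _) ⊕ Option (TA : Type _) → galH1Torsion (A.baseChange K) ((2 ^ M : ℕ) : ℤ) :=
    Sum.elim (fun o ↦ o.elim gA fun t ↦ (t : galH1Torsion (A.baseChange K) ((2 ^ M : ℕ) : ℤ)))
      (fun o ↦ o.elim (wA gA) fun t ↦ wA t)
  let csB : Option (TB : Type _) ⊕ Option (TB : Type _) → galH1Torsion (B.baseChange K) ((2 ^ M : ℕ) : ℤ) :=
    Sum.elim (fun o ↦ o.elim gB fun t ↦ (t : galH1Torsion (B.baseChange K) ((2 ^ M : ℕ) : ℤ)))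
      (fun o ↦ o.elim (wB gB) fun t ↦ wB t)
  obtain ⟨ℓ, hbℓ, hℓ, hℓA, hℓB, hℓd, hℓ2, hℓP, hFA, hFB, m, hmA, hmB, hcritA, hcritB⟩ :=
    exists_kolyvaginPrime_gt_of_galoisElement_pair (A := A) (B := B) (NA := NA) (NB := NB)
      Literature.NumberTheory.Automorphic.chebotarev_artinRep_holds hK Nat.prime_two (M := M) hc₀ ht
      hinv csA csB hρA hρB b
  -- the generating sets lie in the ranges of the families
  have hgenA : insert gA (insert (wA gA) ((TA : Set _) ∪ wA '' (TA : Set _))) ⊆ Set.range csA := by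
    rintro x (rfl | rfl | hx | ⟨t, ht', rfl⟩)
    exacts [⟨Sum.inl none, rfl⟩, ⟨Sum.inr none, rfl⟩, ⟨Sum.inl (some ⟨x, hx⟩), rfl⟩,
      ⟨Sum.inr (some ⟨t, ht'⟩), rfl⟩]
  have hgenB : insert gB (insert (wB gB) ((TB : Set _) ∪ wB '' (TB : Set _))) ⊆ Set.range csB := by
    rintro x (rfl | rfl | hx | ⟨t, ht', rfl⟩)
    exacts [⟨Sum.inl none, rfl⟩, ⟨Sum.inr none, rfl⟩, ⟨Sum.inl (some ⟨x, hx⟩), rfl⟩,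
      ⟨Sum.inr (some ⟨t, ht'⟩), rfl⟩]
  exact ⟨ℓ, hbℓ, hℓ, hℓA, hℓB, hℓd, hℓ2, hℓP, hFA, hFB,
    kernelForm_of_localCriterion A (2 ^ M) rfl fnA hfnA ht hinv hrelA hKerA πA hπA2 hπAτ TA gA hgA hTA
      iA uA hiA huApiv hρA hTA0 hvA csA hmA hgenA hℓ hℓP hcritA,
    kernelForm_of_localCriterion B (2 ^ M) rfl fnB hfnB ht hinv hrelB hKerB πB hπB2 hπBτ TB gB hgB hTB
      iB uB hiB huBpiv hρB hTB0 hvB csB hmB hgenB hℓ hℓP hcritB⟩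

end Main

end Summit.BirchSwinnertonDyer.BirchSwinnertonDyer.Theorems.SylvesterTwoCoupledTelescope

end
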